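import Mathlib
import Literature.NumberTheory.LFunctions.Zhang2022.SkeletonPartOne
import Literature.NumberTheory.LFunctions.Zhang2022.SkeletonAssembly
import HarnessLib

/-!
# Zhang (2022), typed skeleton: the inner edge of §4 — Lemma 4.3 from Lemmas 4.1 and 4.2,
# kernel-checked (DAG node `Z22:Lem4.3.pf`)

Topic `Literature/NumberTheory/LFunctions/Zhang2022` (Landau–Siegel audit tree; verdict-neutral).
Y. Zhang, *Discrete mean estimates and the Landau–Siegel zero*, arXiv:2211.02515v1 (2022)
[Zhang2022LandauSiegel] — **an unrefereed manuscript under adjudication**; the nodes below are the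
skeleton's CLAIM nodes (`SkeletonPartOne`: `Lemma41`, `Lemma42`, `Lemma43`), stated not asserted.
This file proves ONE EDGE between them: the manuscript's proof of Lemma 4.3 (§4, PDF p. 17,
tex L947–L975; DAG node `Z22:Lem4.3.pf` [Z22 p.17, tex L957]),

> Lemma 4.3. Let `Ω₂ = {s : 1/2 − 𝓛⁻¹ < σ < 1 + 𝓛⁻¹, |t − 2πt₀| < 𝓛₁ + 4}`. If `s ∈ Ω₂`, then
> `F′/F(s,ψ) = O(𝓛)`.
> Proof. Assume `|w| ≤ (200𝓛)⁻¹log 𝓛`, so that `s + w ∈ Ω₁`. By Lemma 4.1 and 4.2,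
> `𝓛⁻⁸⁸ ≪ |F(s+w,ψ)| ≪ 𝓛⁸⁸`. Thus the logarithm `𝔩(s,w) := log(F(s+w,ψ)/F(s,ψ))`, which
> vanishes at `w = 0`, is analytic in `w`, and it satisfies `Re{𝔩(s,w)} ≪ log 𝓛`. Since
> `F′/F(s,ψ) = ∂/∂w 𝔩(s,w)|_{w=0}`, the result follows by Lemma 4 of [15, Chapter 2]. □

as the kernel theorem `lemma43_of : Lemma41 → Lemma42 → Lemma43` (for `ψ ∈ Ψ₁`, as the nodes are
typed). "Lemma 4 of [15, Chapter 2]" (Karatsuba, the Borel–Carathéodory lemma) is NOT a named fact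
here: it is the tree THEOREM `Literature.Analysis.Complex.norm_logDeriv_le_of_log_norm_le`, consumed
through the tree's instantiated step `Lemma43.norm_logDeriv_le` (`Zhang2022/Section4Lemma43`:
`𝓛^{−e} ≤ |F| ≤ 𝓛^{e}` on the disc `|z − s| < (200𝓛)⁻¹log 𝓛` ⇒ `|F′/F(s)| ≤ 800·e·𝓛`) and its
disc-inclusion `Lemma43.mem_Omega1_of_mem_Omega2` ("so that `s + w ∈ Ω₁`", which needs
`log 𝓛 ≥ 200`). The bookkeeping made explicit: with `|F| + |G| ≤ C₁𝓛⁷⁹` (Lemma 4.1) and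
`|FG − 1| ≤ C₂𝓛⁻²²⁷` (Lemma 4.2) on `Ω₁`, once `𝓛 ≥ 2max(C₁,1)`, `𝓛 ≥ 2max(C₂,1)` and
`𝓛 ≥ e²⁰⁰` one has `|FG| ≥ 1/2`, hence `𝓛⁻⁸⁰ ≤ 1/(2C₁𝓛⁷⁹) ≤ |F| ≤ C₁𝓛⁷⁹ ≤ 𝓛⁸⁰` on the disc
(the manuscript's `88` is generous; one extra power of `𝓛` absorbs the implied constants), so
`e = 80` and the edge's constant is `C₄₃ = 800·80 = 64000`. The threshold `𝓛 = log D ≥ e²⁰⁰` is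
one of the manuscript's "`D` sufficiently large" thresholds, carried by `ForAllLarge`.

What is NOT asserted: Lemmas 4.1 and 4.2 themselves (they remain CLAIM nodes, resting on the mean
values (3.4), (3.6)), hence not Lemma 4.3 as such. Nothing about Theorems 1–2 of the source is
stated or implied; nothing here bears on the cell's verdict on (8.24).

## References

* Y. Zhang, arXiv:2211.02515v1 (2022), §4 Lemmas 4.1–4.3 (PDF pp. 16–17, tex L899–L975).
  [cite: Zhang2022LandauSiegel, §4 Lemma 4.3]
* A. A. Karatsuba, *Basic Analytic Number Theory*, Springer 1993, Ch. 2 Lemma 4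
  (Borel–Carathéodory) — a tree theorem via `Literature/Analysis/Complex/BorelCaratheodoryDeriv.lean`.
  [cite: MontgomeryVaughan2007, Ch. 6, Lemma 6.2]
-/

noncomputable section

open Complex Real Metric Set

namespace Literature.NumberTheory.LFunctions.Zhang2022.Skeleton

variable {D : ℕ} (χ : DirichletCharacter ℂ D)

/-! ## The implicit inputs of the proof of Lemma 4.3 -/

/-- "`𝔩(s,w)` … is analytic in `w`": `F(s,ψ) = Σ_{n≤D⁴} ν(n)ψ(n)n^{−s}` is an entire function of
`s` (a finite Dirichlet polynomial). [cite: Zhang2022LandauSiegel, §4 Lemma 4.3 (proof)] -/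
theorem differentiable_Fpoly (x : Chr D) : Differentiable ℂ (Fpoly χ x) := by
  have h : Fpoly χ x = fun s => ∑ n ∈ Finset.Icc 1 (D ^ 4),
      nu χ n * x.ψ (n : ZMod x.p) * (n : ℂ) ^ (-s) := rfl
  rw [h]
  refine Differentiable.fun_sum fun n hn => ?_
  have hn0 : (n : ℂ) ≠ 0 := by
    exact_mod_cast Nat.one_le_iff_ne_zero.mp (Finset.mem_Icc.mp hn).1
  exact (differentiable_id.neg.const_cpow (Or.inl hn0)).const_mul _

/-- The "`D` sufficiently large" bookkeeping: for `D ≥ ⌈e^M⌉`, `𝓛 = log D ≥ M`.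
[cite: Zhang2022LandauSiegel, §2 p. 4] -/
theorem le_ell_of_ceil_exp_le {M : ℝ} (hD : ⌈Real.exp M⌉₊ ≤ D) : M ≤ ell D := by
  have h : Real.exp M ≤ D := le_trans (Nat.le_ceil _) (by exact_mod_cast hD)
  rw [ell]
  exact (Real.le_log_iff_exp_le (lt_of_lt_of_le (Real.exp_pos _) h)).mpr h

/-- **"By Lemma 4.1 and 4.2, `𝓛⁻⁸⁸ ≪ |F(s+w,ψ)| ≪ 𝓛⁸⁸`"**, EXACT with its constants: from
`|F| + |G| ≤ C₁𝓛⁷⁹` and `|FG − 1| ≤ C₂𝓛⁻²²⁷` at a point, once `2max(C₁,1) ≤ 𝓛` and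
`2max(C₂,1) ≤ 𝓛` (so `𝓛 ≥ 2`): `𝓛⁻⁸⁰ ≤ |F| ≤ 𝓛⁸⁰`. [cite: Zhang2022LandauSiegel, §4 Lemma 4.3 (proof)] -/
theorem norm_F_two_sided {F G : ℂ} {L C₁ C₂ : ℝ} (hC₁ : 2 * max C₁ 1 ≤ L)
    (hC₂ : 2 * max C₂ 1 ≤ L) (h41 : ‖F‖ + ‖G‖ ≤ C₁ * L ^ 79)
    (h42 : ‖F * G - 1‖ ≤ C₂ * (L ^ 227)⁻¹) :
    (L ^ 80)⁻¹ ≤ ‖F‖ ∧ ‖F‖ ≤ L ^ 80 := by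
  have hm1 : 1 ≤ max C₁ 1 := le_max_right _ _
  have hm2 : 1 ≤ max C₂ 1 := le_max_right _ _
  have hL2 : 2 ≤ L := by linarith
  have hL0 : 0 < L := by linarith
  have hpow79 : 0 < L ^ 79 := by positivity
  have hpow80 : 0 < L ^ 80 := by positivity
  have hF0 : 0 ≤ ‖F‖ := norm_nonneg _
  have hG0 : 0 ≤ ‖G‖ := norm_nonneg _
  -- upper bounds `|F|, |G| ≤ C₁𝓛⁷⁹ ≤ (𝓛/2)·𝓛⁷⁹`
  have hC₁L : C₁ * L ^ 79 ≤ L / 2 * L ^ 79 := by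
    gcongr
    linarith [le_max_left C₁ 1]
  have hFup : ‖F‖ ≤ L / 2 * L ^ 79 := by linarith
  have hGup : ‖G‖ ≤ L / 2 * L ^ 79 := by linarith
  -- `|FG − 1| ≤ 1/2`, so `|F||G| ≥ 1/2`
  have h227 : C₂ * (L ^ 227)⁻¹ ≤ 1 / 2 := by
    have h1 : L ≤ L ^ 227 := le_self_pow₀ (by linarith) (by norm_num)
    have h2 : 2 * max C₂ 1 ≤ L ^ 227 := hC₂.trans h1
    have h3 : C₂ ≤ max C₂ 1 := le_max_left _ _
    rw [← div_eq_mul_inv, div_le_iff₀ (by positivity)]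
    linarith
  have hFG : 1 / 2 ≤ ‖F‖ * ‖G‖ := by
    have h := norm_sub_norm_le (1 : ℂ) (F * G)
    rw [norm_one, norm_sub_rev, norm_mul] at h
    linarith
  refine ⟨?_, ?_⟩
  · -- `1/2 ≤ |F||G| ≤ |F|·𝓛⁸⁰/2`
    have h1 : ‖F‖ * ‖G‖ ≤ ‖F‖ * (L / 2 * L ^ 79) := by gcongr
    have h2 : 1 ≤ ‖F‖ * L ^ 80 := by nlinarith
    rw [inv_eq_one_div, div_le_iff₀ hpow80]
    exact h2
  · calc ‖F‖ ≤ L / 2 * L ^ 79 := hFup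
      _ ≤ L * L ^ 79 := by gcongr; linarith
      _ = L ^ 80 := by ring

/-! ## The edge: Lemma 4.3 from Lemmas 4.1 and 4.2 -/

/-- **`Z22:Lem4.3.pf` [Z22 p.17, tex L957–L975], the proof of Lemma 4.3** as a kernel edge between the
skeleton's nodes:
Lemma 4.1 (`|F| + |G| ≪ 𝓛⁷⁹` on `Ω₁`) and Lemma 4.2 (`FG = 1 + O(𝓛⁻²²⁷)` on `Ω₁`) imply Lemma 4.3
(`F′/F = O(𝓛)` on `Ω₂`), for `ψ ∈ Ψ₁` and all large `D`, with `C₄₃ = 64000`: for `s ∈ Ω₂` the disc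
`|z − s| < (200𝓛)⁻¹log 𝓛` lies in `Ω₁` (`log 𝓛 ≥ 200`), `𝓛⁻⁸⁰ ≤ |F| ≤ 𝓛⁸⁰` there
(`norm_F_two_sided`), and the Borel–Carathéodory step `Lemma43.norm_logDeriv_le` (`e = 80`) gives
`|F′/F(s)| ≤ 800·80·𝓛`. DAG node `Z22:Lem4.3.pf`; Lemmas 4.1, 4.2 remain CLAIM nodes.
[cite: Zhang2022LandauSiegel, §4 Lemma 4.3] -/
theorem lemma43_of (h41 : Lemma41) (h42 : Lemma42) : Lemma43 := by
  obtain ⟨C₁, h1⟩ := h41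
  obtain ⟨C₂, h2⟩ := h42
  obtain ⟨D₀, h12⟩ := h1.and h2
  refine ⟨64000, max D₀ ⌈Real.exp (max (Real.exp 200) (2 * max C₁ 1 + 2 * max C₂ 1))⌉₊,
    fun D _ χ hD hq hp => ?_⟩
  intro x hx s hs
  obtain ⟨h41D, h42D⟩ := h12 D χ (le_trans (le_max_left _ _) hD) hq hp
  -- the thresholds: `𝓛 ≥ e²⁰⁰`, `𝓛 ≥ 2max(C₁,1)`, `𝓛 ≥ 2max(C₂,1)`
  have hKℓ : max (Real.exp 200) (2 * max C₁ 1 + 2 * max C₂ 1) ≤ ell D :=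
    le_ell_of_ceil_exp_le (le_trans (le_max_right _ _) hD)
  have h200 : Real.exp 200 ≤ ell D := le_trans (le_max_left _ _) hKℓ
  have hsum : 2 * max C₁ 1 + 2 * max C₂ 1 ≤ ell D := le_trans (le_max_right _ _) hKℓ
  have hm1 : 1 ≤ max C₁ 1 := le_max_right _ _
  have hm2 : 1 ≤ max C₂ 1 := le_max_right _ _
  have hC₁ℓ : 2 * max C₁ 1 ≤ ell D := by linarith
  have hC₂ℓ : 2 * max C₂ 1 ≤ ell D := by linarith
  have hℓ1 : 1 < ell D := by
    have : (1 : ℝ) < Real.exp 200 := Real.one_lt_exp_iff.mpr (by norm_num)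
    linarith
  have hℓ0 : 0 < ell D := by linarith
  have hlog : 200 ≤ Real.log (ell D) := by
    rw [Real.le_log_iff_exp_le hℓ0]
    exact h200
  have hsmall : Real.log (ell D) / (200 * ell D) ≤ 1 := by
    rw [div_le_one (by positivity)]
    have := Real.log_le_sub_one_of_pos hℓ0
    linarith
  -- "Assume `|w| ≤ (200𝓛)⁻¹log 𝓛`, so that `s + w ∈ Ω₁`"
  have hball : ∀ z ∈ ball s (Real.log (ell D) / (200 * ell D)), z ∈ Omega1 D := by
    intro z hz
    have hw : ‖z - s‖ ≤ Real.log (ell D) / (200 * ell D) := (mem_ball_iff_norm.mp hz).le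
    have h := Lemma43.mem_Omega1_of_mem_Omega2 (L₁ := ell1 D) (t₀ := t0 D) hℓ0 hlog hsmall hs hw
    have e : s + (z - s) = z := by ring
    rw [e] at h
    exact h
  -- "`𝓛⁻⁸⁸ ≪ |F(s+w,ψ)| ≪ 𝓛⁸⁸`" (here `𝓛⁻⁸⁰ ≤ |F| ≤ 𝓛⁸⁰`)
  have htwo : ∀ z ∈ ball s (Real.log (ell D) / (200 * ell D)),
      (ell D ^ 80)⁻¹ ≤ ‖Fpoly χ x z‖ ∧ ‖Fpoly χ x z‖ ≤ ell D ^ 80 := fun z hz =>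
    norm_F_two_sided hC₁ℓ hC₂ℓ (h41D x hx z (hball z hz)) (h42D x hx z (hball z hz))
  have e80 : ell D ^ (80 : ℝ) = ell D ^ (80 : ℕ) := by exact_mod_cast Real.rpow_natCast (ell D) 80
  have hlo : ∀ z ∈ ball s (Real.log (ell D) / (200 * ell D)),
      ell D ^ (-(80 : ℝ)) ≤ ‖Fpoly χ x z‖ := by
    intro z hz
    rw [Real.rpow_neg hℓ0.le, e80]
    exact (htwo z hz).1
  have hhi : ∀ z ∈ ball s (Real.log (ell D) / (200 * ell D)),
      ‖Fpoly χ x z‖ ≤ ell D ^ (80 : ℝ) := by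
    intro z hz
    rw [e80]
    exact (htwo z hz).2
  -- "the result follows by Lemma 4 of [15, Chapter 2]" (Borel–Carathéodory, tree theorem)
  have key := Lemma43.norm_logDeriv_le hℓ1 (by norm_num : (0 : ℝ) < 80)
    (differentiable_Fpoly χ x).differentiableOn hlo hhi
  linarith

end Literature.NumberTheory.LFunctions.Zhang2022.Skeleton
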